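import Mathlib.LinearAlgebra.QuadraticForm.Basic
import Mathlib.LinearAlgebra.SesquilinearForm.Orthogonal
import Mathlib.Tactic.LinearCombination
import HarnessLib

/-!
# Orthogonal bases for hermitian forms over a field with involution ([Lang2002, Ch. XV §5])

Topic `LinearAlgebra/Semilinear`; namespace `Literature.LinearAlgebra.Semilinear`.  KERNEL ONLY (theorems; no named
fact, no `sorry`).  The sesquilinear twin of Mathlib's `LinearMap.BilinForm.exists_orthogonal_basis` (symmetric
bilinear forms, `2` invertible), i.e. the two lemmas marked "todo: Generalize this to sesquilinear maps" in
`Mathlib/LinearAlgebra/SesquilinearForm/Orthogonal.lean` plus the induction of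
`Mathlib/LinearAlgebra/QuadraticForm/Basic.lean`.

Setting: `K` a field, `J : K →+* K`, `V` a finite-dimensional `K`-space, `B : V →ₛₗ[J] V →ₗ[K] K` a form
`J`-semilinear in the first and linear in the second variable which is HERMITIAN in Mathlib's sense
`LinearMap.IsSymm B : J (B x y) = B y x`.  [Lang2002, Ch. XV §5] (hermitian forms; "the proof of Theorem 3.1 goes
through"): if `2 ≠ 0` and `J` moves some `δ ≠ 0` to `-δ` (an involution "of the second kind", e.g. the conjugation of
a quadratic extension), then

* a non-zero `J`-sesquilinear form has a non-isotropic vector (`exists_self_ne_zero_of_ne_zero`: if `B(x, x) = 0` for all `x`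
  then polarisation gives `B(x, y) = -B(y, x)`, testing with `δ • x` gives `B(x, y) = B(y, x)`, so `2 B(x, y) = 0`);
* for `B(x, x) ≠ 0`, `V = K x ⊕ (K x)^⊥` (`isCompl_span_singleton_orthogonalBilin`; Mathlib's todo);
* **`V` has a `B`-orthogonal basis** (`exists_orthogonal_basis_of_isSymm`), by induction on `dim V`.

Used by `NumberTheory/Weil1964/LocalWeilIndexHermitianRes` (Weil index of the restriction of scalars of a hermitian
form, [HarrisKudlaSweet1996, §1]; [Kudla1994, §3]).

## References

* S. Lang, *Algebra*, rev. 3rd ed., GTM 211 (2002), Ch. XV §5 (hermitian forms), cf. §3 Thm 3.1 [Lang2002].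
-/

set_option autoImplicit false

open Module

namespace Literature.LinearAlgebra.Semilinear

variable {K : Type*} [Field K] {V : Type*} [AddCommGroup V] [Module K V] {J : K →+* K}

/-- **A non-zero `J`-sesquilinear form has a non-isotropic vector** when `2 ≠ 0` and `J δ = -δ` for some `δ ≠ 0`
(no symmetry needed: an alternating `J`-sesquilinear form with `J ≠ 1` vanishes). [cite: Lang2002, Ch. XV §5] -/
theorem exists_self_ne_zero_of_ne_zero {B : V →ₛₗ[J] V →ₗ[K] K} (hB0 : B ≠ 0)
    (h2 : (2 : K) ≠ 0) {δ : K} (hδ : δ ≠ 0) (hJδ : J δ = -δ) : ∃ x, B x x ≠ 0 := by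
  by_contra! h
  apply hB0
  ext x y
  -- polarisation: `B x y + B y x = 0`
  have hpol : ∀ x y, B x y = -B y x := fun x y => by
    have e := h (x + y)
    simp only [map_add, LinearMap.add_apply, h x, h y, zero_add, add_zero] at e
    exact eq_neg_of_add_eq_zero_left ((add_comm _ _).trans e)
  -- testing with `δ • x`: `J δ · B x y = -(δ · B y x)`, i.e. `-δ B x y = -δ B y x`
  have e1 := hpol (δ • x) y
  rw [LinearMap.map_smulₛₗ₂, map_smul, smul_eq_mul, smul_eq_mul, hJδ] at e1
  -- combined with `hpol y x`: `2 δ · B x y = 0`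
  have e3 : (2 * δ) * B x y = 0 := by linear_combination (-1 : K) * e1 + δ * hpol y x
  rw [LinearMap.zero_apply, LinearMap.zero_apply]
  exact (mul_eq_zero.1 e3).resolve_left (mul_ne_zero h2 hδ)

/-- for a sesquilinear form and `B x x ≠ 0`: `(K x)^⊥ = ker (B x)`. [folklore] -/
private theorem orthogonalBilin_span_singleton_eq_ker (B : V →ₛₗ[J] V →ₗ[K] K) (x : V) :
    (K ∙ x).orthogonalBilin B = LinearMap.ker (B x) := by
  ext y
  simp_rw [Submodule.mem_orthogonalBilin_iff, LinearMap.mem_ker, Submodule.mem_span_singleton]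
  constructor
  · exact fun h => h x ⟨1, one_smul _ _⟩
  · rintro h _ ⟨z, rfl⟩
    rw [LinearMap.map_smulₛₗ₂, h, smul_zero]

/-- **`V = K x ⊕ (K x)^⊥` for `B x x ≠ 0`** (sesquilinear version of Mathlib's `isCompl_span_singleton_orthogonal`).
[cite: Lang2002, Ch. XV §5] -/
theorem isCompl_span_singleton_orthogonalBilin {B : V →ₛₗ[J] V →ₗ[K] K} {x : V} (hx : B x x ≠ 0) :
    IsCompl (K ∙ x) ((K ∙ x).orthogonalBilin B) where
  disjoint := disjoint_iff.2 (LinearMap.span_singleton_inf_orthogonal_eq_bot B x hx)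
  codisjoint := codisjoint_iff.2 <| by
    rw [orthogonalBilin_span_singleton_eq_ker]
    exact (B x).span_singleton_sup_ker_eq_top hx

variable [FiniteDimensional K V]

/-- **Orthogonal bases for hermitian forms**: a hermitian (`LinearMap.IsSymm`) sesquilinear form over a field with
`2 ≠ 0`, relative to a ring endomorphism `J` with `J δ = -δ` for some `δ ≠ 0`, admits an orthogonal basis.
[cite: Lang2002, Ch. XV §5] -/
theorem exists_orthogonal_basis_of_isSymm (h2 : (2 : K) ≠ 0) {δ : K} (hδ : δ ≠ 0) (hJδ : J δ = -δ)
    {B : V →ₛₗ[J] V →ₗ[K] K} (hB : B.IsSymm) :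
    ∃ v : Basis (Fin (finrank K V)) K V, B.IsOrthoᵢ v := by
  suffices ∀ d, ∀ (W : Type _) [AddCommGroup W] [Module K W] [FiniteDimensional K W] (B : W →ₛₗ[J] W →ₗ[K] K),
      B.IsSymm → finrank K W = d → ∃ v : Basis (Fin d) K W, B.IsOrthoᵢ v from this _ V B hB rfl
  intro d
  induction d with
  | zero => exact fun W _ _ _ B _ hd => ⟨basisOfFinrankZero hd, fun _ _ _ => map_zero _⟩
  | succ d ih =>
    intro W _ _ _ B hB hd
    obtain rfl | hB0 := eq_or_ne B 0
    · let b := Module.finBasis K W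
      rw [hd] at b
      exact ⟨b, fun i j _ => rfl⟩
    obtain ⟨x, hx⟩ := exists_self_ne_zero_of_ne_zero hB0 h2 hδ hJδ
    rw [← Submodule.finrank_add_eq_of_isCompl (isCompl_span_singleton_orthogonalBilin hx).symm,
      finrank_span_singleton (ne_zero_of_map hx)] at hd
    let B' := B.domRestrict₁₂ ((K ∙ x).orthogonalBilin B) ((K ∙ x).orthogonalBilin B)
    obtain ⟨v', hv₁⟩ := ih _ B' (hB.domRestrict _) (Nat.succ.inj hd)
    let b :=
      Basis.mkFinCons x v'
        (by
          rintro c y hy hc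
          rw [add_eq_zero_iff_neg_eq] at hc
          rw [← hc, Submodule.neg_mem_iff] at hy
          have := (isCompl_span_singleton_orthogonalBilin hx).disjoint
          rw [Submodule.disjoint_def] at this
          have := this (c • x) (Submodule.smul_mem _ _ <| Submodule.mem_span_singleton_self _) hy
          exact (smul_eq_zero.1 this).resolve_right fun h => hx <| h.symm ▸ map_zero _)
        (by
          intro y
          refine ⟨-B x y / B x x, fun z hz => ?_⟩
          obtain ⟨c, rfl⟩ := Submodule.mem_span_singleton.1 hz
          rw [LinearMap.map_smulₛₗ₂, map_add, map_smul, smul_eq_mul, smul_eq_mul,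
            div_mul_cancel₀ _ hx, add_neg_cancel, mul_zero])
    refine ⟨b, ?_⟩
    rw [Basis.coe_mkFinCons]
    intro j i
    refine Fin.cases ?_ (fun i => ?_) i <;> refine Fin.cases ?_ (fun j => ?_) j <;> intro hij <;>
      simp only [Function.onFun, Fin.cons_zero, Fin.cons_succ, Function.comp_apply]
    · exact (hij rfl).elim
    · rw [← hB.eq, show B x _ = 0 from (v' j).prop _ (Submodule.mem_span_singleton_self x), map_zero]
    · exact (v' i).prop _ (Submodule.mem_span_singleton_self x)
    · exact hv₁ (fun h => hij (congrArg Fin.succ h))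

end Literature.LinearAlgebra.Semilinear
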